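/-
COR-CM (cells pub-hodgecm / pub-hodgecm2, stage 2 of the Hodge ladder) — HM-EQUALITY Δ2 / X3, the summand-form bridge of
`Transposition/Item6PlacementJunctionAppendixCSummands.lean` (p308232 ✔) RE-BASED ON THE PORTED PACKAGE CODES: the record `T` lives
over the PORTED finite-adelic unitary group `↥V.adelicFin` of a PORTED hermitian 3-space `V : HodgeCM.HermSpace3 L ι₁` (root
`Summits/HodgeConjecture/HodgeCM/`, namespaces `HodgeCM.*` kept by `port_pkg`), its levels are the PORTED `HodgeCM.Level V` read through
`HodgeCM.Level.K` — i.e. `T` has EXACTLY the type of `(HodgeCM.Model.liuDictionaryPin …).toLiuAlbaneseModuleDatum` (package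
`Model/LiuDictionaryPin.lean` :170, port layer 67) — and the three level binders `hmono`/`hoc`/`hcof` are DISCHARGED.  The Appendix-C
datum is b25's honest Prop-C.5 datum `Model.honestP5Of h` at the tree codes WITH THE SAME FIELD AND THE SAME HERMITIAN MATRIX, written
with anonymous constructors (`⟨L.K⟩`, `⟨V.Hm, …⟩`) so that no definition is introduced; its group is `↥V.adelicFin` by `rfl`.
pin-3 = prover-pub-hodgecm2-pin-3-g3-0 (Δ2 / X3 co-owner per COORDINATOR RULINGS 2026-08-21T19:17:21Z and 22:05:29Z (2)).  Theorems
only: no definition, no instance, no named fact, no `variable`, no proof holes; nothing landed is edited or restated.  FRAMING: HC_CM is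
NOT proved; this file discharges no COR-CM binder and no pin; «Δ2 BRIDGE CLOSED» is NOT claimed.
-/
import Summits.HodgeConjecture.CorCM.B01.Transposition.Item6PlacementJunctionAppendixCSummands
import Summits.HodgeConjecture.CorCM.B01.Transposition.HComp.HonestP5Of
import Summits.HodgeConjecture.CorCM.B01.Transposition.HComp.Levels
import Summits.HodgeConjecture.HodgeCM.CM.Basic
import HarnessLib

set_option autoImplicit false

/-!
# Δ2 in one theorem over the PORTED codes: `Thm418AsPrintedC C (R μ)` + (σ, e) + (J) + (C) + D-side `hnv`/`hmult` ⟹ `T.Thm418Combined res cmCl`, for `T` over `↥V.adelicFin` / `HodgeCM.Level.K`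

WHY THIS FILE.  The `h418` binder that the ported package head consumes (item6-p2's staged `CorCM/PortJoin/Closed.lean`; package
`Model/PeriodThmFFace.lean` :176) is, for every PORTED `(L, ι₁, V, a₀)`, the proposition
`(HodgeCM.Model.liuDictionaryPin hHD hI h₁ h₃ hA V (LiuIndex.I V …) (LiuIndex.line V …)).Thm418C`, and
`LiuDictionary.Thm418C := T.Thm418Combined T.res T.cmClasses` (package `Model/LiuDictionary.lean` :210) for the record
`T.toLiuAlbaneseModuleDatum : LiuAlbaneseModuleDatum ↥V.adelicFin (HodgeCM.Level.K : HodgeCM.Level V → Subgroup ↥V.adelicFin)`.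
The junction p308232 is stated for a record over the group `P5.G` of an Appendix-C datum and abstract levels `Kof : Lvl → Subgroup P5.G`
with three level hypotheses.  Here the SAME theorem is read at
* `P5 := Model.honestP5Of h ⟨L.K⟩ ι₁ ⟨V.Hm, V.isHermitian, V.signature_ι₁, V.posDef_of_ne⟩ Φ` — the tree's honest Prop-C.5 datum
  ([Liu2021] App. C l. 4618–4624, Prop. C.5; `HComp/HonestP5Of.lean`, b25) at the tree CM-field code `⟨L.K⟩ : CorCM.CMField` and the tree
  hermitian code `⟨V.Hm, …⟩ : CorCM.HermSpace3 ⟨L.K⟩ ι₁` carrying the ported `V`'s own matrix; its group `(honestP5Of …).G` is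
  `↥V.adelicFin` DEFINITIONALLY (`honestP5Of_G` + both code copies spell `adelicFin` as the one Literature constant
  `UnitaryGroup.finAdelic L⁺ L c̄ 3 V.Hm`), recorded as `honestP5Of_G_pkgCodes` below — this is the X3 row «`G ↔ V.adelicFin`» AT THE
  PORTED CODES, closed by `rfl`;
* `Lvl := HodgeCM.Level V`, `Kof := HodgeCM.Level.K` — the ported levels; `hmono` is `HodgeCM.Level.le_def` (levels are ORDERED BY `K`),
  `hoc` is `⟨Γ.isOpen_K, Γ.isCompact_K⟩`, and `hcof` («below every open compact `K₀ ≤ U(V)(𝔸_f)` there is a level», [Liu2021] l. 2060 /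
  2239 «sufficiently small», App. C l. 4627) is the tree level `HComp.levelOfSmall ⟨K₀ ⊓ K_f(3), _⟩` of `HComp/Levels.lean` (pin-1 /
  hcomp-level: torsion-free arithmetic level by Minkowski at `3`) re-read as a ported level with the same six fields
  (`pkgLevel_exists_K_le`).
Everything else — ONE §4.2 datum `C : Sec42Data P5 iso`, the family `R μ : Thm418Rest C`, THE CITE `hLiu μ : Thm418AsPrintedC C (R μ)`
([Liu2021] Thm. 4.18 EXACTLY AS PRINTED, l. 2232–2245), (Ω) `σ`/`hσ`/`e`/`he`, (J) `J`/`hJ`/`hJinj`, `Dμ`, (C) `hpin`, `hnvD`, `hmultD` — is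
p308232's binder list VERBATIM with `P5.G` spelled `↥V.adelicFin` and `Kof K` spelled `K.K`.  KERNEL: one application of
`LiuAlbaneseModuleDatum.thm418Combined_of_thm418AsPrintedC_summands`.  AT THE PIN (port layer 67, file
`Transposition/Item6PlacementJunctionAppendixCAtDictionary.lean` to follow): `T := (liuDictionaryPin …).toLiuAlbaneseModuleDatum`,
`res := T'.res`, `cmCl := T'.cmClasses` makes the conclusion LITERALLY `T'.Thm418C`; the record's readings there are `rfl`
(`T'.Char = I`, `T'.Ω i a = (line i).Ω (ιVE V) a.1`, `T'.H = Tower …`, `T'.adm i d ↔ d.IsReflexOfTypeG ι₁ (line i).lineType`; package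
`Model/LiuDictionaryInstanceLevel.lean` :253–262).  WHAT REMAINS of Δ2 after this file: exactly the instance pins (X1: `J`; X3: `R`,
`σ`/`e`; the `adm` contract X2b inside `hpin`), the D-side printed sentences `hnvD`/`hmultD`, and the port.  HC_CM is NOT proved.

References: Y. Liu, arXiv:2102.11518 = Camb. J. Math. 9 (2021) (`FJcycle.tex` md5 6db49a74122d): Lem. 2.4 l. 1210–1213, Def. 4.5
l. 1936–1964, Prop. 4.6 (1) l. 1969, §4.2 l. 2053–2074, Def. 4.11 l. 2083–2097, Prop. 4.13 l. 2113–2119 (proof l. 2145), Thm. 4.18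
l. 2232–2245 (proof l. 2247–2268), App. C l. 4599, l. 4618–4624, Prop. C.5 l. 4624–4637, App. D Lem. D.1.
-/

noncomputable section

open scoped DirectSum TensorProduct

namespace Summit.HodgeConjecture.CorCM.Transposition

open Literature.AlgebraicGeometry.ShimuraVarieties.UnitaryCanonicalModel
open Literature.NumberTheory.Automorphic.Liu2021 Literature.NumberTheory.Automorphic.Liu2021.AppendixC

variable {L : HodgeCM.CMField} {ι₁ : L →+* ℂ} (V : HodgeCM.HermSpace3 L ι₁)

/-- **X3 row «`G ↔ V.adelicFin`» AT THE PORTED CODES, by `rfl`.**  The group of the tree's honest Prop-C.5 datum ([Liu2021] App. C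
l. 4618: `G = 𝔾(𝔸_F^∞) = U(V)(𝔸_{F,f})`) taken at the tree CM-field code `⟨L.K⟩` and the tree hermitian code `⟨V.Hm, …⟩` of a PORTED
hermitian 3-space `V : HodgeCM.HermSpace3 L ι₁` IS the ported `↥V.adelicFin` (both code copies spell `adelicFin` as
`UnitaryGroup.finAdelic L⁺ L c̄ 3 V.Hm`; b25's `honestP5Of_G`).  Nothing is asserted beyond a definitional unfolding.
[cite: Liu2021, App. C l. 4618] -/
theorem honestP5Of_G_pkgCodes (h : exists_recordSystem) (Φ : Literature.AlgebraicGeometry.Motives.CMType L) :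
    (Model.honestP5Of h ⟨L.K⟩ ι₁ ⟨V.Hm, V.isHermitian, V.signature_ι₁, V.posDef_of_ne⟩ Φ).G = ↥V.adelicFin := rfl

/-- **«sufficiently small»: below every open compact subgroup of `U(V)(𝔸_{F,f})` there is a PORTED level** ([Liu2021] §4.2 l. 2060,
Thm. 4.18 (1) l. 2239, App. C l. 4599 «neat» / Prop. C.5 l. 4627–4628) — the `hcof` binder of p306833/p308232 for
`Kof := HodgeCM.Level.K`: the tree level `HComp.levelOfSmall ⟨K₀ ⊓ K_f(3), _⟩` (`HComp/Levels.lean`: arithmetic level `U(V)(F) ∩ K`,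
torsion-free by Minkowski since `K ≤ K_f(3)`) re-read as a ported `HodgeCM.Level V` with the same six fields; its `K` is `K₀ ⊓ K_f(3) ≤ K₀`.
[cite: Liu2021, §4.2 l. 2060 and Thm. 4.18 (1) l. 2239 and Prop. C.5 l. 4627–4628] -/
theorem pkgLevel_exists_K_le :
    ∀ K₀ : Subgroup ↥V.adelicFin, IsOpenCompact K₀ → ∃ K₁ : HodgeCM.Level V, K₁.K ≤ K₀ := fun K₀ hK₀ => by
  -- the tree hermitian code with the same field and the same matrix (its `adelicFin` is `V.adelicFin` by `rfl`)
  let Vt : HermSpace3 (⟨L.K⟩ : CMField) ι₁ := ⟨V.Hm, V.isHermitian, V.signature_ι₁, V.posDef_of_ne⟩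
  -- the tree level of the sufficiently small open compact `K₀ ⊓ K_f(3)`
  let Γ := HComp.levelOfSmall Vt
    ⟨(C5.OpenCompactSubgroup.ofIsOpenCompact K₀ hK₀).inf (HComp.K3 Vt), C5.OpenCompactSubgroup.inf_le_right _ _⟩
  exact ⟨⟨Γ.Γ, Γ.K, Γ.isCompact_K, Γ.isOpen_K, Γ.arithmeticLevel_K, Γ.torsionFree⟩, C5.OpenCompactSubgroup.inf_le_left _ _⟩

end Summit.HodgeConjecture.CorCM.Transposition

namespace HodgeCM.Literature.Theta

namespace LiuAlbaneseModuleDatum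

open Summit.HodgeConjecture.CorCM
open Literature.AlgebraicGeometry.ShimuraVarieties.UnitaryCanonicalModel
open Literature.NumberTheory.Automorphic.Liu2021 Literature.NumberTheory.Automorphic.Liu2021.AppendixC NumberField

universe w

/-- **Δ2 IN ONE THEOREM, SUMMAND FORM, OVER THE PORTED CODES — [Liu2021, Thm. 4.18] AS PRINTED at the Appendix-C datum (one
`Thm418Rest` per character) + per-summand identifications + the proof's realisation + the D-side printed sentences ⟹ the package's
combined reading r8 `T.Thm418Combined res cmCl`** for every record `T` over the PORTED group `↥V.adelicFin` and the PORTED levels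
`HodgeCM.Level.K` of a ported `V : HodgeCM.HermSpace3 L ι₁` — the exact type of `(HodgeCM.Model.liuDictionaryPin …).toLiuAlbaneseModuleDatum`,
where `res := T'.res`, `cmCl := T'.cmClasses` make the conclusion `LiuDictionary.Thm418C`.  Binders: `h` ([Deligne1979] 2.2.5 / 2.7.21,
the named fact behind the honest App-C datum), `Φ` (not read by the datum); ONE §4.2 datum `C` (l. 2053–2074) at
`honestP5Of h ⟨L.K⟩ ι₁ ⟨V.Hm, …⟩ Φ` (App. C l. 4618–4624, Prop. C.5; group `= ↥V.adelicFin` by `rfl`); per `μ` with `τ' ∈ Φ_μ`: `R μ`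
(Def. 4.5 (2) l. 1944–1952, Def. 4.11, Def. 4.16), `hLiu μ` = Thm. 4.18 EXACTLY AS PRINTED (l. 2232–2245) for `toThm418Data C (R μ)`, (Ω)
`σ μ` injective (`hσ`) with `e μ a : T.Ω μ a ≃ ω(μ, σ a)` equivariant (`he`), (J) `J μ` with `hJ` (l. 2250) and `hJinj` (l. 2250–2268),
`Dμ μ` (Prop. 4.6 (1)), (C) `hpin μ` (Lem. 2.4 (1) l. 1210–1213 + the `cmCl` contract), `hnvD μ` (Def. 4.11 / Lem. D.1 (1)) and `hmultD μ`
(proof of Prop. 4.13, l. 2145) ON LIU'S SUMMANDS.  The LEVEL binders of p308232 are DISCHARGED: «ordered by `K`» (`HodgeCM.Level.le_def`),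
«open compact» (`Γ.isOpen_K`, `Γ.isCompact_K`), «sufficiently small» (`pkgLevel_exists_K_le`, l. 2060 / 2239 / 4627).  KERNEL: p308232's
`thm418Combined_of_thm418AsPrintedC_summands` at these arguments.  HC_CM is NOT proved; no pin is discharged here; nothing is asserted
about Liu's objects; «Δ2 BRIDGE CLOSED» is NOT claimed.
[cite: Liu2021, Thm. 4.18 (FJcycle.tex l. 2232–2245) with proof l. 2247–2268, Thm. 4.18 (1) (l. 2239), Lem. 2.4 (1) (l. 1210–1213), Prop. 4.13 proof l. 2145, Def. 4.11, App. D Lem. D.1 (1), §4.2 l. 2053–2074, App. C l. 4618–4624, Prop. C.5 (l. 4624–4637)]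
[cite: Deligne1979ShimuraVarieties, 2.2.5 and Cor. 2.7.21] -/
theorem thm418Combined_of_thm418AsPrintedC_summands_pkg
    {L : HodgeCM.CMField} {ι₁ : L →+* ℂ} (V : HodgeCM.HermSpace3 L ι₁)
    (h : exists_recordSystem) (Φ : Literature.AlgebraicGeometry.Motives.CMType L)
    {isotropicAt : ℕ → Prop}
    (C : Sec42Data (Model.honestP5Of h ⟨L.K⟩ ι₁ ⟨V.Hm, V.isHermitian, V.signature_ι₁, V.posDef_of_ne⟩ Φ) isotropicAt)
    (T : LiuAlbaneseModuleDatum ↥V.adelicFin (HodgeCM.Level.K : HodgeCM.Level V → Subgroup ↥V.adelicFin))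
    {W : HodgeCM.Level V → Type w} [∀ K, AddCommGroup (W K)] [∀ K, Module ℂ (W K)]
    (res : ∀ K : HodgeCM.Level V, T.H →ₗ[ℂ] W K) (cmCl : ∀ K : HodgeCM.Level V, T.Char → Set (W K))
    (R : ∀ μ : T.Char, T.PhiMu μ → Thm418Rest C)
    (hLiu : ∀ (μ : T.Char) (hμ : T.PhiMu μ), Thm418AsPrintedC C (R μ hμ))
    (σ : ∀ (μ : T.Char) (hμ : T.PhiMu μ), T.Adm μ → (toThm418Data C (R μ hμ)).AdmIndex)
    (hσ : ∀ (μ : T.Char) (hμ : T.PhiMu μ), Function.Injective (σ μ hμ))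
    (e : ∀ (μ : T.Char) (hμ : T.PhiMu μ) (a : T.Adm μ), T.Ω μ a ≃ₗ[ℂ] (toThm418Data C (R μ hμ)).omegaAt (σ μ hμ a))
    (he : ∀ (μ : T.Char) (hμ : T.PhiMu μ) (a : T.Adm μ) (g : ↥V.adelicFin) (m : T.Ω μ a),
      e μ hμ a (MonoidAlgebra.of ℂ ↥V.adelicFin g • m) = (toThm418Data C (R μ hμ)).rhoAt (σ μ hμ a) g (e μ hμ a m))
    (J : ∀ (μ : T.Char) (hμ : T.PhiMu μ),
      ℂ ⊗[fieldOfValues L (toThm418Data C (R μ hμ)).μ] (toThm418Data C (R μ hμ)).Ω →ₗ[ℂ] T.H)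
    (hJinj : ∀ (μ : T.Char) (hμ : T.PhiMu μ), Function.Injective (J μ hμ))
    (hJ : ∀ (μ : T.Char) (hμ : T.PhiMu μ) (g : ↥V.adelicFin)
      (x : ℂ ⊗[fieldOfValues L (toThm418Data C (R μ hμ)).μ] (toThm418Data C (R μ hμ)).Ω),
      J μ hμ (((toThm418Data C (R μ hμ)).rhoΩ g).baseChange ℂ x) = MonoidAlgebra.of ℂ ↥V.adelicFin g • J μ hμ x)
    (Dμ : ∀ (μ : T.Char) (hμ : T.PhiMu μ), (toThm418Data C (R μ hμ)).Obj)
    (hpin : ∀ (μ : T.Char) (hμ : T.PhiMu μ) (K : HodgeCM.Level V) (φ : (toThm418Data C (R μ hμ)).HomK K.K (Dμ μ hμ)),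
      res K (J μ hμ ((1 : ℂ) ⊗ₜ[fieldOfValues L (toThm418Data C (R μ hμ)).μ] (toThm418Data C (R μ hμ)).res K.K (Dμ μ hμ) φ))
        ∈ cmCl K μ)
    (hnvD : ∀ (μ : T.Char) (hμ : T.PhiMu μ) (i : (toThm418Data C (R μ hμ)).AdmIndex),
      Nontrivial ((toThm418Data C (R μ hμ)).omegaAt i))
    (hmultD : ∀ (μ : T.Char) (hμ : T.PhiMu μ) (i : (toThm418Data C (R μ hμ)).AdmIndex),
      Module.rank ℂ (Representation.IntertwiningMap ((toThm418Data C (R μ hμ)).rhoAt i)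
        (Representation.ofModule' (k := ℂ) (G := ↥V.adelicFin) T.H)) ≤ 1) :
    T.Thm418Combined res cmCl :=
  thm418Combined_of_thm418AsPrintedC_summands C T res cmCl
    (fun _ _ hle => HodgeCM.Level.le_def.mp hle) (fun Γ => ⟨Γ.isOpen_K, Γ.isCompact_K⟩)
    (Transposition.pkgLevel_exists_K_le V) R hLiu σ hσ e he J hJinj hJ Dμ hpin hnvD hmultD

end LiuAlbaneseModuleDatum

end HodgeCM.Literature.Theta

end
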